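import Summits.CriticalPhenomena.PercolationContinuityZ3.Theorems.PercNearOneGluingNoHeavyLowerTailAPLUnionClosure
import Summits.CriticalPhenomena.PercolationContinuityZ3.Theorems.PercNearOneGluingNoHeavyLowerTailAPLCellsBasic
import Summits.CriticalPhenomena.PercolationContinuityZ3.Theorems.PercNearOneGluingNoHeavyLowerTailAPLPieceCells
import Summits.CriticalPhenomena.PercolationContinuityZ3.Theorems.PercNearOneGluingNoHeavyLowerTailAPLForestSplit
import HarnessLib

/-!
# `NoHeavyLowerTail` (stmt-CriticalPhenomena-4575) — THEOREM F_T: CONJECTURE F (with Harris and APL-G) on every weighted graph whose forest part is acyclic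

Support file (prover prim-ineq-gen-8 gen 36; `--supports stmt-CriticalPhenomena-4575`; memos
run/shared/lean/prim/prim-ineq-gen-8/FINDING-gen34-CONJF.md §2 (the induction), FINDING-gen36-LEMMA-U.md §4–§5).  No definitions, no named
facts, no sorries.

SETTING.  A finite vertex type `V`, weights `p : Sym2 V → ℝ` with `0 ≤ p ≤ 1`, an edge set `D : Finset (Sym2 V)` WITHOUT LOOPS, distinct
terminals `a, b, c`.  The cells of `(a; b, c)` on `D` are the `DecisionTree.PrW D p`-probabilities of the five cluster events
(`…APLGluedCells.lean`); for `prodBernoulli` these are `P(a|b|c), P(ab|c), P(ac|b), P(a|bc), P(abc)` (`DecisionTree.prodBernoulli_real_eq_PrW`).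
FOREST HYPOTHESIS (acyclicity of the forest part `F = D.filter (b ∉ · ∧ c ∉ ·)`, stated in bridge form): every edge `s(u,v) ∈ F` separates
`u` from `v` in `F ∖ {s(u,v)}`.
THE REGION `K`: `F_b ≥ 0 ∧ F_c ≥ 0 ∧ Harris (eS ≤ TD) ∧ APL-G ((TD − eS)² ≤ uab·uac·S²)` of the cells (GZ (5.1) is not carried: it holds for
the cells of every edge set, `cells_gz`).
* `forest_mono`, `noLoop_mono` — the hypotheses pass to sub-edge-sets;
* `region_glue` — `K(D₁) ∧ K(D₂) ⟹ K(D₁ ∪ D₂)` for disjoint edge sets glued at the terminals (`glued_cell_*` + `cells_gz` + `region_union`);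
* `region_pendant` — `K` for `(g; b, c)` on `D.erase s(a,g)` ⟹ `K` for `(a; b, c)` on `D` when `a` hangs on `g` (`pendant_cell_*`, scaling by `z`);
* `region_afree`, `region_bEdge`, `region_cEdge` — the base pieces lie in `K` (`afree_cell_*`, `bEdge_cell_*`, `cEdge_cell_*`);
* **`conjF_forest`** — THEOREM F_T: under the forest hypothesis the cells of `(a; b, c)` on `D` lie in `K`; in particular prim-cert-1's
  CONJECTURE F (`F_b ∧ F_c`, i.e. `2u0u3 ≤ e·u3 + 3e·ubc + 2·min(uab,uac)·D`) and APL-G (hence APL(2/3), `apl23_of_geom`) hold for every finite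
  weighted graph `G` and terminals with `G ∖ {b, c}` a forest (gen 29 COROLLARY B and gen 34/35 THEOREM F_T, now kernel theorems).
Induction on `|D|` (memo gen 34 §2): peel an `a–b` or `a–c` edge (`region_glue` with a single-edge piece); else if `a` is isolated use `region_afree`;
else take a neighbour `g` of `a` and split `D` at the apex (`…APLForestSplit.lean`): if the rest is nonempty, `region_glue` with two smaller
pieces; if not, `a` is pendant (`apexSplit_apex_edge`, the one use of acyclicity) and `region_pendant` applies to the smaller instance `(g; b, c)`.
[this work; the algebraic inputs are the lineage's `region_union`, `conjF_*_pendant`, `geom_*`]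
-/

namespace Summit.CriticalPhenomena.PercolationContinuityZ3.Theorems

namespace APL

open Literature.Probability.Percolation Literature.Probability.Percolation.Gladkov Literature.Probability.Percolation.DecisionTree
open scoped Classical

variable {V : Type*} [Fintype V] [DecidableEq V]

omit [Fintype V] in
/-- The forest hypothesis passes to sub-edge-sets. [folklore] -/
theorem forest_mono {D D' : Finset (Sym2 V)} (hsub : D' ⊆ D) (b c : V)
    (hF : (∀ u v : V, s(u, v) ∈ D → b ∉ s(u, v) → c ∉ s(u, v) →
        ¬ (openGraph (↑((D.filter fun f => b ∉ f ∧ c ∉ f).erase s(u, v)) : Set (Sym2 V))).Reachable u v)) :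
    (∀ u v : V, s(u, v) ∈ D' → b ∉ s(u, v) → c ∉ s(u, v) →
        ¬ (openGraph (↑((D'.filter fun f => b ∉ f ∧ c ∉ f).erase s(u, v)) : Set (Sym2 V))).Reachable u v) := by
  intro u v huv hb hc hreach
  refine hF u v (hsub huv) hb hc (hreach.mono (openGraph_mono (Finset.coe_subset.2 ?_)))
  exact Finset.erase_subset_erase _ (Finset.filter_subset_filter _ hsub)

omit [Fintype V] [DecidableEq V] in
/-- No loops in a sub-edge-set. [folklore] -/
theorem noLoop_mono {D D' : Finset (Sym2 V)} (hsub : D' ⊆ D) (h : (∀ f ∈ D, ¬ f.IsDiag)) : (∀ f ∈ D', ¬ f.IsDiag) :=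
  fun f hf => h f (hsub hf)

set_option maxHeartbeats 0 in
/-- **Gluing step**: the region `K` passes to the union of two disjoint edge sets glued at the terminals (`0 ≤ p ≤ 1`). [folklore] -/
theorem region_glue {p : Sym2 V → ℝ} (hp0 : ∀ e, 0 ≤ p e) (hp1 : ∀ e, p e ≤ 1) (D₁ D₂ : Finset (Sym2 V)) (hdisj : Disjoint D₁ D₂)
    (a b c : V) (hsep : ∀ v : V, (∃ e ∈ D₁, v ∈ e) → (∃ e ∈ D₂, v ∈ e) → (v = a ∨ v = b ∨ v = c))
    (h₁ : (0 ≤ 3*(PrW D₁ p {K : Finset (Sym2 V) | b ∈ cl K a ∧ c ∉ cl K a}+PrW D₁ p {K : Finset (Sym2 V) | c ∈ cl K a ∧ b ∉ cl K a})*(PrW D₁ p {K : Finset (Sym2 V) | b ∉ cl K a ∧ c ∉ cl K a ∧ c ∉ cl K b}+PrW D₁ p {K : Finset (Sym2 V) | b ∈ cl K a ∧ c ∉ cl K a}+PrW D₁ p {K : Finset (Sym2 V) | c ∈ cl K a ∧ b ∉ cl K a}+PrW D₁ p {K : Finset (Sym2 V) | b ∉ cl K a ∧ c ∉ cl K a ∧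 c ∈ cl K b}+PrW D₁ p {K : Finset (Sym2 V) | b ∈ cl K a ∧ c ∈ cl K a}) - (PrW D₁ p {K : Finset (Sym2 V) | b ∉ cl K a ∧ c ∉ cl K a ∧ c ∉ cl K b}+PrW D₁ p {K : Finset (Sym2 V) | b ∈ cl K a ∧ c ∉ cl K a}+PrW D₁ p {K : Finset (Sym2 V) | c ∈ cl K a ∧ b ∉ cl K a})*(PrW D₁ p {K : Finset (Sym2 V) | b ∈ cl K a ∧ c ∉ cl K a}+3*PrW D₁ p {K : Finset (Sym2 V) | c ∈ cl K a ∧ b ∉ cl K a}+2*PrW D₁ p {K : Finset (Sym2 V) | b ∈ cl K a ∧ c ∈ cl K a})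
      ∧ 0 ≤ 3*(PrW D₁ p {K : Finset (Sym2 V) | b ∈ cl K a ∧ c ∉ cl K a}+PrW D₁ p {K : Finset (Sym2 V) | c ∈ cl K a ∧ b ∉ cl K a})*(PrW D₁ p {K : Finset (Sym2 V) | b ∉ cl K a ∧ c ∉ cl K a ∧ c ∉ cl K b}+PrW D₁ p {K : Finset (Sym2 V) | b ∈ cl K a ∧ c ∉ cl K a}+PrW D₁ p {K : Finset (Sym2 V) | c ∈ cl K a ∧ b ∉ cl K a}+PrW D₁ p {K : Finset (Sym2 V) | b ∉ cl K a ∧ c ∉ cl K a ∧ c ∈ cl K b}+PrW D₁ p {K : Finset (Sym2 V) | b ∈ cl K a ∧ c ∈ cl K a}) - (PrW D₁ p {K : Finset (Sym2 V) | b ∉ cl K a ∧ c ∉ cl K a ∧ c ∉ cl K b}+PrW D₁ p {K : Finset (Sym2 V) | b ∈ cl K a ∧ c ∉ cl K a}+PrW D₁ p {K : Finset (Sym2 V) | c ∈ cl K a ∧ b ∉ cl K a})*(3*PrW D₁ p {K : Finset (Sym2 V) | b ∈ cl K a ∧ c ∉ cl K a}+PrW D₁ p {K : Finset (Sym2 V)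 | c ∈ cl K a ∧ b ∉ cl K a}+2*PrW D₁ p {K : Finset (Sym2 V) | b ∈ cl K a ∧ c ∈ cl K a})
      ∧ (PrW D₁ p {K : Finset (Sym2 V) | b ∈ cl K a ∧ c ∉ cl K a}+PrW D₁ p {K : Finset (Sym2 V) | c ∈ cl K a ∧ b ∉ cl K a})*(PrW D₁ p {K : Finset (Sym2 V) | b ∉ cl K a ∧ c ∉ cl K a ∧ c ∉ cl K b}+PrW D₁ p {K : Finset (Sym2 V) | b ∈ cl K a ∧ c ∉ cl K a}+PrW D₁ p {K : Finset (Sym2 V) | c ∈ cl K a ∧ b ∉ cl K a}+PrW D₁ p {K : Finset (Sym2 V) | b ∉ cl K a ∧ c ∉ cl K a ∧ c ∈ cl K b}+PrW D₁ p {K : Finset (Sym2 V) | b ∈ cl K a ∧ c ∈ cl K a})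
        ≤ (PrW D₁ p {K : Finset (Sym2 V) | b ∈ cl K a ∧ c ∉ cl K a}+PrW D₁ p {K : Finset (Sym2 V) | c ∈ cl K a ∧ b ∉ cl K a}+PrW D₁ p {K : Finset (Sym2 V) | b ∈ cl K a ∧ c ∈ cl K a})*(PrW D₁ p {K : Finset (Sym2 V) | b ∉ cl K a ∧ c ∉ cl K a ∧ c ∉ cl K b}+PrW D₁ p {K : Finset (Sym2 V) | b ∈ cl K a ∧ c ∉ cl K a}+PrW D₁ p {K : Finset (Sym2 V) | c ∈ cl K a ∧ b ∉ cl K a})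
      ∧ ((PrW D₁ p {K : Finset (Sym2 V) | b ∈ cl K a ∧ c ∉ cl K a}+PrW D₁ p {K : Finset (Sym2 V) | c ∈ cl K a ∧ b ∉ cl K a}+PrW D₁ p {K : Finset (Sym2 V) | b ∈ cl K a ∧ c ∈ cl K a})*(PrW D₁ p {K : Finset (Sym2 V) | b ∉ cl K a ∧ c ∉ cl K a ∧ c ∉ cl K b}+PrW D₁ p {K : Finset (Sym2 V) | b ∈ cl K a ∧ c ∉ cl K a}+PrW D₁ p {K : Finset (Sym2 V) | c ∈ cl K a ∧ b ∉ cl K a}) - (PrW D₁ p {K : Finset (Sym2 V) | b ∈ cl K a ∧ c ∉ cl K a}+PrW D₁ p {K : Finset (Sym2 V) | c ∈ cl K a ∧ b ∉ cl K a})*(PrW D₁ p {K : Finset (Sym2 V) | b ∉ cl K a ∧ c ∉ cl K a ∧ c ∉ cl K b}+PrW D₁ p {K : Finset (Sym2 V) | b ∈ cl K a ∧ c ∉ cl K a}+PrW D₁ p {K : Finset (Sym2 V) | c ∈ cl K a ∧ b ∉ cl K a}+PrW D₁ p {K : Finset (Sym2 V) | b ∉ cl K a ∧ c ∉ cl K a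 ∧ c ∈ cl K b}+PrW D₁ p {K : Finset (Sym2 V) | b ∈ cl K a ∧ c ∈ cl K a}))^2
        ≤ PrW D₁ p {K : Finset (Sym2 V) | b ∈ cl K a ∧ c ∉ cl K a}*PrW D₁ p {K : Finset (Sym2 V) | c ∈ cl K a ∧ b ∉ cl K a}*(PrW D₁ p {K : Finset (Sym2 V) | b ∉ cl K a ∧ c ∉ cl K a ∧ c ∉ cl K b}+PrW D₁ p {K : Finset (Sym2 V) | b ∈ cl K a ∧ c ∉ cl K a}+PrW D₁ p {K : Finset (Sym2 V) | c ∈ cl K a ∧ b ∉ cl K a}+PrW D₁ p {K : Finset (Sym2 V) | b ∉ cl K a ∧ c ∉ cl K a ∧ c ∈ cl K b}+PrW D₁ p {K : Finset (Sym2 V) | b ∈ cl K a ∧ c ∈ cl K a})^2))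
    (h₂ : (0 ≤ 3*(PrW D₂ p {K : Finset (Sym2 V) | b ∈ cl K a ∧ c ∉ cl K a}+PrW D₂ p {K : Finset (Sym2 V) | c ∈ cl K a ∧ b ∉ cl K a})*(PrW D₂ p {K : Finset (Sym2 V) | b ∉ cl K a ∧ c ∉ cl K a ∧ c ∉ cl K b}+PrW D₂ p {K : Finset (Sym2 V) | b ∈ cl K a ∧ c ∉ cl K a}+PrW D₂ p {K : Finset (Sym2 V) | c ∈ cl K a ∧ b ∉ cl K a}+PrW D₂ p {K : Finset (Sym2 V) | b ∉ cl K a ∧ c ∉ cl K a ∧ c ∈ cl K b}+PrW D₂ p {K : Finset (Sym2 V) | b ∈ cl K a ∧ c ∈ cl K a}) - (PrW D₂ p {K : Finset (Sym2 V) | b ∉ cl K a ∧ c ∉ cl K a ∧ c ∉ cl K b}+PrW D₂ p {K : Finset (Sym2 V) | b ∈ cl K a ∧ c ∉ cl K a}+PrW D₂ p {K : Finset (Sym2 V) | c ∈ cl K a ∧ b ∉ cl K a})*(PrW D₂ p {K : Finset (Sym2 V) | b ∈ cl K a ∧ c ∉ cl K a}+3*PrW D₂ p {K : Finset (Sym2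 V) | c ∈ cl K a ∧ b ∉ cl K a}+2*PrW D₂ p {K : Finset (Sym2 V) | b ∈ cl K a ∧ c ∈ cl K a})
      ∧ 0 ≤ 3*(PrW D₂ p {K : Finset (Sym2 V) | b ∈ cl K a ∧ c ∉ cl K a}+PrW D₂ p {K : Finset (Sym2 V) | c ∈ cl K a ∧ b ∉ cl K a})*(PrW D₂ p {K : Finset (Sym2 V) | b ∉ cl K a ∧ c ∉ cl K a ∧ c ∉ cl K b}+PrW D₂ p {K : Finset (Sym2 V) | b ∈ cl K a ∧ c ∉ cl K a}+PrW D₂ p {K : Finset (Sym2 V) | c ∈ cl K a ∧ b ∉ cl K a}+PrW D₂ p {K : Finset (Sym2 V) | b ∉ cl K a ∧ c ∉ cl K a ∧ c ∈ cl K b}+PrW D₂ p {K : Finset (Sym2 V) | b ∈ cl K a ∧ c ∈ cl K a}) - (PrW D₂ p {K : Finset (Sym2 V) | b ∉ cl K a ∧ c ∉ cl K a ∧ c ∉ cl K b}+PrW D₂ p {K : Finset (Sym2 V) | b ∈ cl K a ∧ c ∉ cl K a}+PrW D₂ p {K : Finset (Sym2 V) | c ∈ cl K a ∧ b ∉ cl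 K a})*(3*PrW D₂ p {K : Finset (Sym2 V) | b ∈ cl K a ∧ c ∉ cl K a}+PrW D₂ p {K : Finset (Sym2 V) | c ∈ cl K a ∧ b ∉ cl K a}+2*PrW D₂ p {K : Finset (Sym2 V) | b ∈ cl K a ∧ c ∈ cl K a})
      ∧ (PrW D₂ p {K : Finset (Sym2 V) | b ∈ cl K a ∧ c ∉ cl K a}+PrW D₂ p {K : Finset (Sym2 V) | c ∈ cl K a ∧ b ∉ cl K a})*(PrW D₂ p {K : Finset (Sym2 V) | b ∉ cl K a ∧ c ∉ cl K a ∧ c ∉ cl K b}+PrW D₂ p {K : Finset (Sym2 V) | b ∈ cl K a ∧ c ∉ cl K a}+PrW D₂ p {K : Finset (Sym2 V) | c ∈ cl K a ∧ b ∉ cl K a}+PrW D₂ p {K : Finset (Sym2 V) | b ∉ cl K a ∧ c ∉ cl K a ∧ c ∈ cl K b}+PrW D₂ p {K : Finset (Sym2 V) | b ∈ cl K a ∧ c ∈ cl K a})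
        ≤ (PrW D₂ p {K : Finset (Sym2 V) | b ∈ cl K a ∧ c ∉ cl K a}+PrW D₂ p {K : Finset (Sym2 V) | c ∈ cl K a ∧ b ∉ cl K a}+PrW D₂ p {K : Finset (Sym2 V) | b ∈ cl K a ∧ c ∈ cl K a})*(PrW D₂ p {K : Finset (Sym2 V) | b ∉ cl K a ∧ c ∉ cl K a ∧ c ∉ cl K b}+PrW D₂ p {K : Finset (Sym2 V) | b ∈ cl K a ∧ c ∉ cl K a}+PrW D₂ p {K : Finset (Sym2 V) | c ∈ cl K a ∧ b ∉ cl K a})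
      ∧ ((PrW D₂ p {K : Finset (Sym2 V) | b ∈ cl K a ∧ c ∉ cl K a}+PrW D₂ p {K : Finset (Sym2 V) | c ∈ cl K a ∧ b ∉ cl K a}+PrW D₂ p {K : Finset (Sym2 V) | b ∈ cl K a ∧ c ∈ cl K a})*(PrW D₂ p {K : Finset (Sym2 V) | b ∉ cl K a ∧ c ∉ cl K a ∧ c ∉ cl K b}+PrW D₂ p {K : Finset (Sym2 V) | b ∈ cl K a ∧ c ∉ cl K a}+PrW D₂ p {K : Finset (Sym2 V) | c ∈ cl K a ∧ b ∉ cl K a}) - (PrW D₂ p {K : Finset (Sym2 V) | b ∈ cl K a ∧ c ∉ cl K a}+PrW D₂ p {K : Finset (Sym2 V) | c ∈ cl K a ∧ b ∉ cl K a})*(PrW D₂ p {K : Finset (Sym2 V) | b ∉ cl K a ∧ c ∉ cl K a ∧ c ∉ cl K b}+PrW D₂ p {K : Finset (Sym2 V) | b ∈ cl K a ∧ c ∉ cl K a}+PrW D₂ p {K : Finset (Sym2 V) | c ∈ cl K a ∧ b ∉ cl K a}+PrW D₂ p {K : Finset (Sym2 V) | b ∉ cl K a ∧ c ∉ cl K a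 ∧ c ∈ cl K b}+PrW D₂ p {K : Finset (Sym2 V) | b ∈ cl K a ∧ c ∈ cl K a}))^2
        ≤ PrW D₂ p {K : Finset (Sym2 V) | b ∈ cl K a ∧ c ∉ cl K a}*PrW D₂ p {K : Finset (Sym2 V) | c ∈ cl K a ∧ b ∉ cl K a}*(PrW D₂ p {K : Finset (Sym2 V) | b ∉ cl K a ∧ c ∉ cl K a ∧ c ∉ cl K b}+PrW D₂ p {K : Finset (Sym2 V) | b ∈ cl K a ∧ c ∉ cl K a}+PrW D₂ p {K : Finset (Sym2 V) | c ∈ cl K a ∧ b ∉ cl K a}+PrW D₂ p {K : Finset (Sym2 V) | b ∉ cl K a ∧ c ∉ cl K a ∧ c ∈ cl K b}+PrW D₂ p {K : Finset (Sym2 V) | b ∈ cl K a ∧ c ∈ cl K a})^2)) :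
    (0 ≤ 3*(PrW (D₁ ∪ D₂) p {K : Finset (Sym2 V) | b ∈ cl K a ∧ c ∉ cl K a}+PrW (D₁ ∪ D₂) p {K : Finset (Sym2 V) | c ∈ cl K a ∧ b ∉ cl K a})*(PrW (D₁ ∪ D₂) p {K : Finset (Sym2 V) | b ∉ cl K a ∧ c ∉ cl K a ∧ c ∉ cl K b}+PrW (D₁ ∪ D₂) p {K : Finset (Sym2 V) | b ∈ cl K a ∧ c ∉ cl K a}+PrW (D₁ ∪ D₂) p {K : Finset (Sym2 V) | c ∈ cl K a ∧ b ∉ cl K a}+PrW (D₁ ∪ D₂) p {K : Finset (Sym2 V) | b ∉ cl K a ∧ c ∉ cl K a ∧ c ∈ cl K b}+PrW (D₁ ∪ D₂) p {K : Finset (Sym2 V) | b ∈ cl K a ∧ c ∈ cl K a}) - (PrW (D₁ ∪ D₂) p {K : Finset (Sym2 V) | b ∉ cl K a ∧ c ∉ cl K a ∧ c ∉ cl K b}+PrW (D₁ ∪ D₂) p {K : Finset (Sym2 V) | b ∈ cl K a ∧ c ∉ cl K a}+PrW (D₁ ∪ D₂) p {K : Finset (Sym2 V) | c ∈ cl K a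 ∧ b ∉ cl K a})*(PrW (D₁ ∪ D₂) p {K : Finset (Sym2 V) | b ∈ cl K a ∧ c ∉ cl K a}+3*PrW (D₁ ∪ D₂) p {K : Finset (Sym2 V) | c ∈ cl K a ∧ b ∉ cl K a}+2*PrW (D₁ ∪ D₂) p {K : Finset (Sym2 V) | b ∈ cl K a ∧ c ∈ cl K a})
      ∧ 0 ≤ 3*(PrW (D₁ ∪ D₂) p {K : Finset (Sym2 V) | b ∈ cl K a ∧ c ∉ cl K a}+PrW (D₁ ∪ D₂) p {K : Finset (Sym2 V) | c ∈ cl K a ∧ b ∉ cl K a})*(PrW (D₁ ∪ D₂) p {K : Finset (Sym2 V) | b ∉ cl K a ∧ c ∉ cl K a ∧ c ∉ cl K b}+PrW (D₁ ∪ D₂) p {K : Finset (Sym2 V) | b ∈ cl K a ∧ c ∉ cl K a}+PrW (D₁ ∪ D₂) p {K : Finset (Sym2 V) | c ∈ cl K a ∧ b ∉ cl K a}+PrW (D₁ ∪ D₂) p {K : Finset (Sym2 V) | b ∉ cl K a ∧ c ∉ cl K a ∧ c ∈ cl K b}+PrW (D₁ ∪ D₂) p {K : Finset (Sym2 V) |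 b ∈ cl K a ∧ c ∈ cl K a}) - (PrW (D₁ ∪ D₂) p {K : Finset (Sym2 V) | b ∉ cl K a ∧ c ∉ cl K a ∧ c ∉ cl K b}+PrW (D₁ ∪ D₂) p {K : Finset (Sym2 V) | b ∈ cl K a ∧ c ∉ cl K a}+PrW (D₁ ∪ D₂) p {K : Finset (Sym2 V) | c ∈ cl K a ∧ b ∉ cl K a})*(3*PrW (D₁ ∪ D₂) p {K : Finset (Sym2 V) | b ∈ cl K a ∧ c ∉ cl K a}+PrW (D₁ ∪ D₂) p {K : Finset (Sym2 V) | c ∈ cl K a ∧ b ∉ cl K a}+2*PrW (D₁ ∪ D₂) p {K : Finset (Sym2 V) | b ∈ cl K a ∧ c ∈ cl K a})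
      ∧ (PrW (D₁ ∪ D₂) p {K : Finset (Sym2 V) | b ∈ cl K a ∧ c ∉ cl K a}+PrW (D₁ ∪ D₂) p {K : Finset (Sym2 V) | c ∈ cl K a ∧ b ∉ cl K a})*(PrW (D₁ ∪ D₂) p {K : Finset (Sym2 V) | b ∉ cl K a ∧ c ∉ cl K a ∧ c ∉ cl K b}+PrW (D₁ ∪ D₂) p {K : Finset (Sym2 V) | b ∈ cl K a ∧ c ∉ cl K a}+PrW (D₁ ∪ D₂) p {K : Finset (Sym2 V) | c ∈ cl K a ∧ b ∉ cl K a}+PrW (D₁ ∪ D₂) p {K : Finset (Sym2 V) | b ∉ cl K a ∧ c ∉ cl K a ∧ c ∈ cl K b}+PrW (D₁ ∪ D₂) p {K : Finset (Sym2 V) | b ∈ cl K a ∧ c ∈ cl K a})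
        ≤ (PrW (D₁ ∪ D₂) p {K : Finset (Sym2 V) | b ∈ cl K a ∧ c ∉ cl K a}+PrW (D₁ ∪ D₂) p {K : Finset (Sym2 V) | c ∈ cl K a ∧ b ∉ cl K a}+PrW (D₁ ∪ D₂) p {K : Finset (Sym2 V) | b ∈ cl K a ∧ c ∈ cl K a})*(PrW (D₁ ∪ D₂) p {K : Finset (Sym2 V) | b ∉ cl K a ∧ c ∉ cl K a ∧ c ∉ cl K b}+PrW (D₁ ∪ D₂) p {K : Finset (Sym2 V) | b ∈ cl K a ∧ c ∉ cl K a}+PrW (D₁ ∪ D₂) p {K : Finset (Sym2 V) | c ∈ cl K a ∧ b ∉ cl K a})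
      ∧ ((PrW (D₁ ∪ D₂) p {K : Finset (Sym2 V) | b ∈ cl K a ∧ c ∉ cl K a}+PrW (D₁ ∪ D₂) p {K : Finset (Sym2 V) | c ∈ cl K a ∧ b ∉ cl K a}+PrW (D₁ ∪ D₂) p {K : Finset (Sym2 V) | b ∈ cl K a ∧ c ∈ cl K a})*(PrW (D₁ ∪ D₂) p {K : Finset (Sym2 V) | b ∉ cl K a ∧ c ∉ cl K a ∧ c ∉ cl K b}+PrW (D₁ ∪ D₂) p {K : Finset (Sym2 V) | b ∈ cl K a ∧ c ∉ cl K a}+PrW (D₁ ∪ D₂) p {K : Finset (Sym2 V) | c ∈ cl K a ∧ b ∉ cl K a}) - (PrW (D₁ ∪ D₂) p {K : Finset (Sym2 V) | b ∈ cl K a ∧ c ∉ cl K a}+PrW (D₁ ∪ D₂) p {K : Finset (Sym2 V) | c ∈ cl K a ∧ b ∉ cl K a})*(PrW (D₁ ∪ D₂) p {K : Finset (Sym2 V) | b ∉ cl K a ∧ c ∉ cl K a ∧ c ∉ cl K b}+PrW (D₁ ∪ D₂) p {K : Finset (Sym2 V) | b ∈ cl K a ∧ c ∉ cl K a}+PrW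 (D₁ ∪ D₂) p {K : Finset (Sym2 V) | c ∈ cl K a ∧ b ∉ cl K a}+PrW (D₁ ∪ D₂) p {K : Finset (Sym2 V) | b ∉ cl K a ∧ c ∉ cl K a ∧ c ∈ cl K b}+PrW (D₁ ∪ D₂) p {K : Finset (Sym2 V) | b ∈ cl K a ∧ c ∈ cl K a}))^2
        ≤ PrW (D₁ ∪ D₂) p {K : Finset (Sym2 V) | b ∈ cl K a ∧ c ∉ cl K a}*PrW (D₁ ∪ D₂) p {K : Finset (Sym2 V) | c ∈ cl K a ∧ b ∉ cl K a}*(PrW (D₁ ∪ D₂) p {K : Finset (Sym2 V) | b ∉ cl K a ∧ c ∉ cl K a ∧ c ∉ cl K b}+PrW (D₁ ∪ D₂) p {K : Finset (Sym2 V) | b ∈ cl K a ∧ c ∉ cl K a}+PrW (D₁ ∪ D₂) p {K : Finset (Sym2 V) | c ∈ cl K a ∧ b ∉ cl K a}+PrW (D₁ ∪ D₂) p {K : Finset (Sym2 V) | b ∉ cl K a ∧ c ∉ cl K a ∧ c ∈ cl K b}+PrW (D₁ ∪ D₂) p {K : Finset (Sym2 V) | b ∈ cl K a ∧ c ∈ cl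 K a})^2) := by
  obtain ⟨n0, n1, n2, n3, n4⟩ := cells_nonneg hp0 hp1 D₁ a b c
  obtain ⟨m0, m1, m2, m3, m4⟩ := cells_nonneg hp0 hp1 D₂ a b c
  have g₁ := cells_gz hp0 hp1 D₁ a b c
  have g₂ := cells_gz hp0 hp1 D₂ a b c
  obtain ⟨rb, rc, _, rh, rg⟩ := region_union (PrW D₁ p {K : Finset (Sym2 V) | b ∉ cl K a ∧ c ∉ cl K a ∧ c ∉ cl K b}) (PrW D₁ p {K : Finset (Sym2 V) | b ∈ cl K a ∧ c ∉ cl K a}) (PrW D₁ p {K : Finset (Sym2 V) | c ∈ cl K a ∧ b ∉ cl K a}) (PrW D₁ p {K : Finset (Sym2 V) | b ∉ cl K a ∧ c ∉ cl K a ∧ c ∈ cl K b}) (PrW D₁ p {K : Finset (Sym2 V) | b ∈ cl K a ∧ c ∈ cl K a})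
    (PrW D₂ p {K : Finset (Sym2 V) | b ∉ cl K a ∧ c ∉ cl K a ∧ c ∉ cl K b}) (PrW D₂ p {K : Finset (Sym2 V) | b ∈ cl K a ∧ c ∉ cl K a}) (PrW D₂ p {K : Finset (Sym2 V) | c ∈ cl K a ∧ b ∉ cl K a}) (PrW D₂ p {K : Finset (Sym2 V) | b ∉ cl K a ∧ c ∉ cl K a ∧ c ∈ cl K b}) (PrW D₂ p {K : Finset (Sym2 V) | b ∈ cl K a ∧ c ∈ cl K a})
    n0 n1 n2 n3 n4 m0 m1 m2 m3 m4 h₁.1 h₁.2.1 g₁ h₁.2.2.1 h₁.2.2.2 h₂.1 h₂.2.1 g₂ h₂.2.2.1 h₂.2.2.2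
  rw [glued_cell_zero p D₁ D₂ hdisj a b c hsep, glued_cell_ab p D₁ D₂ hdisj a b c hsep, glued_cell_ac p D₁ D₂ hdisj a b c hsep,
    glued_cell_bc p D₁ D₂ hdisj a b c hsep, glued_cell_three p D₁ D₂ hdisj a b c hsep]
  refine ⟨?_, ?_, ?_, ?_⟩
  · linear_combination rb
  · linear_combination rc
  · linear_combination rh
  · linear_combination rg

set_option maxHeartbeats 0 in
/-- **Pendant step**: if `a` meets exactly the edge `s(a,g)` of `D` (`a ≠ g`, `b, c ≠ a`), the region `K` passes from `(g; b, c)` on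
`D.erase s(a,g)` to `(a; b, c)` on `D` (pendant scaling: `F ↦ zF`, `Δ ↦ zΔ`, `APL-G ↦ z²·APL-G`). [folklore] -/
theorem region_pendant {p : Sym2 V → ℝ} (hp0 : ∀ e, 0 ≤ p e) (D : Finset (Sym2 V)) (a g b c : V) (hag : a ≠ g) (hba : b ≠ a) (hca : c ≠ a)
    (he : s(a, g) ∈ D) (hD : ∀ f ∈ D, a ∈ f → f = s(a, g))
    (h : (0 ≤ 3*(PrW (D.erase s(a, g)) p {K : Finset (Sym2 V) | b ∈ cl K g ∧ c ∉ cl K g}+PrW (D.erase s(a, g)) p {K : Finset (Sym2 V) | c ∈ cl K g ∧ b ∉ cl K g})*(PrW (D.erase s(a, g)) p {K : Finset (Sym2 V) | b ∉ cl K g ∧ c ∉ cl K g ∧ c ∉ cl K b}+PrW (D.erase s(a, g)) p {K : Finset (Sym2 V) | b ∈ cl K g ∧ c ∉ cl K g}+PrW (D.erase s(a, g)) p {K : Finset (Sym2 V) | c ∈ cl K g ∧ b ∉ cl K g}+PrW (D.erase s(a, g)) p {K : Finset (Sym2 V) | b ∉ cl K g ∧ c ∉ cl K g ∧ c ∈ cl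 K b}+PrW (D.erase s(a, g)) p {K : Finset (Sym2 V) | b ∈ cl K g ∧ c ∈ cl K g}) - (PrW (D.erase s(a, g)) p {K : Finset (Sym2 V) | b ∉ cl K g ∧ c ∉ cl K g ∧ c ∉ cl K b}+PrW (D.erase s(a, g)) p {K : Finset (Sym2 V) | b ∈ cl K g ∧ c ∉ cl K g}+PrW (D.erase s(a, g)) p {K : Finset (Sym2 V) | c ∈ cl K g ∧ b ∉ cl K g})*(PrW (D.erase s(a, g)) p {K : Finset (Sym2 V) | b ∈ cl K g ∧ c ∉ cl K g}+3*PrW (D.erase s(a, g)) p {K : Finset (Sym2 V) | c ∈ cl K g ∧ b ∉ cl K g}+2*PrW (D.erase s(a, g)) p {K : Finset (Sym2 V) | b ∈ cl K g ∧ c ∈ cl K g})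
      ∧ 0 ≤ 3*(PrW (D.erase s(a, g)) p {K : Finset (Sym2 V) | b ∈ cl K g ∧ c ∉ cl K g}+PrW (D.erase s(a, g)) p {K : Finset (Sym2 V) | c ∈ cl K g ∧ b ∉ cl K g})*(PrW (D.erase s(a, g)) p {K : Finset (Sym2 V) | b ∉ cl K g ∧ c ∉ cl K g ∧ c ∉ cl K b}+PrW (D.erase s(a, g)) p {K : Finset (Sym2 V) | b ∈ cl K g ∧ c ∉ cl K g}+PrW (D.erase s(a, g)) p {K : Finset (Sym2 V) | c ∈ cl K g ∧ b ∉ cl K g}+PrW (D.erase s(a, g)) p {K : Finset (Sym2 V) | b ∉ cl K g ∧ c ∉ cl K g ∧ c ∈ cl K b}+PrW (D.erase s(a, g)) p {K : Finset (Sym2 V) | b ∈ cl K g ∧ c ∈ cl K g}) - (PrW (D.erase s(a, g)) p {K : Finset (Sym2 V) | b ∉ cl K g ∧ c ∉ cl K g ∧ c ∉ cl K b}+PrW (D.erase s(a, g)) p {K : Finset (Sym2 V) | b ∈ cl K g ∧ c ∉ cl K g}+PrW (D.erase s(a, g)) p {K : Finset (Sym2 V) | c ∈ cl K g ∧ b ∉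 cl K g})*(3*PrW (D.erase s(a, g)) p {K : Finset (Sym2 V) | b ∈ cl K g ∧ c ∉ cl K g}+PrW (D.erase s(a, g)) p {K : Finset (Sym2 V) | c ∈ cl K g ∧ b ∉ cl K g}+2*PrW (D.erase s(a, g)) p {K : Finset (Sym2 V) | b ∈ cl K g ∧ c ∈ cl K g})
      ∧ (PrW (D.erase s(a, g)) p {K : Finset (Sym2 V) | b ∈ cl K g ∧ c ∉ cl K g}+PrW (D.erase s(a, g)) p {K : Finset (Sym2 V) | c ∈ cl K g ∧ b ∉ cl K g})*(PrW (D.erase s(a, g)) p {K : Finset (Sym2 V) | b ∉ cl K g ∧ c ∉ cl K g ∧ c ∉ cl K b}+PrW (D.erase s(a, g)) p {K : Finset (Sym2 V) | b ∈ cl K g ∧ c ∉ cl K g}+PrW (D.erase s(a, g)) p {K : Finset (Sym2 V) | c ∈ cl K g ∧ b ∉ cl K g}+PrW (D.erase s(a, g)) p {K : Finset (Sym2 V) | b ∉ cl K g ∧ c ∉ cl K g ∧ c ∈ cl K b}+PrW (D.erase s(a, g)) p {K : Finset (Sym2 V) | b ∈ cl K g ∧ c ∈ cl K g})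
        ≤ (PrW (D.erase s(a, g)) p {K : Finset (Sym2 V) | b ∈ cl K g ∧ c ∉ cl K g}+PrW (D.erase s(a, g)) p {K : Finset (Sym2 V) | c ∈ cl K g ∧ b ∉ cl K g}+PrW (D.erase s(a, g)) p {K : Finset (Sym2 V) | b ∈ cl K g ∧ c ∈ cl K g})*(PrW (D.erase s(a, g)) p {K : Finset (Sym2 V) | b ∉ cl K g ∧ c ∉ cl K g ∧ c ∉ cl K b}+PrW (D.erase s(a, g)) p {K : Finset (Sym2 V) | b ∈ cl K g ∧ c ∉ cl K g}+PrW (D.erase s(a, g)) p {K : Finset (Sym2 V) | c ∈ cl K g ∧ b ∉ cl K g})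
      ∧ ((PrW (D.erase s(a, g)) p {K : Finset (Sym2 V) | b ∈ cl K g ∧ c ∉ cl K g}+PrW (D.erase s(a, g)) p {K : Finset (Sym2 V) | c ∈ cl K g ∧ b ∉ cl K g}+PrW (D.erase s(a, g)) p {K : Finset (Sym2 V) | b ∈ cl K g ∧ c ∈ cl K g})*(PrW (D.erase s(a, g)) p {K : Finset (Sym2 V) | b ∉ cl K g ∧ c ∉ cl K g ∧ c ∉ cl K b}+PrW (D.erase s(a, g)) p {K : Finset (Sym2 V) | b ∈ cl K g ∧ c ∉ cl K g}+PrW (D.erase s(a, g)) p {K : Finset (Sym2 V) | c ∈ cl K g ∧ b ∉ cl K g}) - (PrW (D.erase s(a, g)) p {K : Finset (Sym2 V) | b ∈ cl K g ∧ c ∉ cl K g}+PrW (D.erase s(a, g)) p {K : Finset (Sym2 V) | c ∈ cl K g ∧ b ∉ cl K g})*(PrW (D.erase s(a, g)) p {K : Finset (Sym2 V) | b ∉ cl K g ∧ c ∉ cl K g ∧ c ∉ cl K b}+PrW (D.erase s(a, g)) p {K : Finset (Sym2 V) | b ∈ cl K g ∧ c ∉ cl K g}+PrW (D.erase s(a,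 g)) p {K : Finset (Sym2 V) | c ∈ cl K g ∧ b ∉ cl K g}+PrW (D.erase s(a, g)) p {K : Finset (Sym2 V) | b ∉ cl K g ∧ c ∉ cl K g ∧ c ∈ cl K b}+PrW (D.erase s(a, g)) p {K : Finset (Sym2 V) | b ∈ cl K g ∧ c ∈ cl K g}))^2
        ≤ PrW (D.erase s(a, g)) p {K : Finset (Sym2 V) | b ∈ cl K g ∧ c ∉ cl K g}*PrW (D.erase s(a, g)) p {K : Finset (Sym2 V) | c ∈ cl K g ∧ b ∉ cl K g}*(PrW (D.erase s(a, g)) p {K : Finset (Sym2 V) | b ∉ cl K g ∧ c ∉ cl K g ∧ c ∉ cl K b}+PrW (D.erase s(a, g)) p {K : Finset (Sym2 V) | b ∈ cl K g ∧ c ∉ cl K g}+PrW (D.erase s(a, g)) p {K : Finset (Sym2 V) | c ∈ cl K g ∧ b ∉ cl K g}+PrW (D.erase s(a, g)) p {K : Finset (Sym2 V) | b ∉ cl K g ∧ c ∉ cl K g ∧ c ∈ cl K b}+PrW (D.erase s(a, g)) p {K : Finset (Sym2 V) | b ∈ cl K g ∧ c ∈ cl K g})^2)) :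
    (0 ≤ 3*(PrW D p {K : Finset (Sym2 V) | b ∈ cl K a ∧ c ∉ cl K a}+PrW D p {K : Finset (Sym2 V) | c ∈ cl K a ∧ b ∉ cl K a})*(PrW D p {K : Finset (Sym2 V) | b ∉ cl K a ∧ c ∉ cl K a ∧ c ∉ cl K b}+PrW D p {K : Finset (Sym2 V) | b ∈ cl K a ∧ c ∉ cl K a}+PrW D p {K : Finset (Sym2 V) | c ∈ cl K a ∧ b ∉ cl K a}+PrW D p {K : Finset (Sym2 V) | b ∉ cl K a ∧ c ∉ cl K a ∧ c ∈ cl K b}+PrW D p {K : Finset (Sym2 V) | b ∈ cl K a ∧ c ∈ cl K a}) - (PrW D p {K : Finset (Sym2 V) | b ∉ cl K a ∧ c ∉ cl K a ∧ c ∉ cl K b}+PrW D p {K : Finset (Sym2 V) | b ∈ cl K a ∧ c ∉ cl K a}+PrW D p {K : Finset (Sym2 V) | c ∈ cl K a ∧ b ∉ cl K a})*(PrW D p {K : Finset (Sym2 V) | b ∈ cl K a ∧ c ∉ cl K a}+3*PrW D p {K : Finset (Sym2 V) | c ∈ cl K a ∧ b ∉ cl K a}+2*PrW D p {K : Finset (Sym2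 V) | b ∈ cl K a ∧ c ∈ cl K a})
      ∧ 0 ≤ 3*(PrW D p {K : Finset (Sym2 V) | b ∈ cl K a ∧ c ∉ cl K a}+PrW D p {K : Finset (Sym2 V) | c ∈ cl K a ∧ b ∉ cl K a})*(PrW D p {K : Finset (Sym2 V) | b ∉ cl K a ∧ c ∉ cl K a ∧ c ∉ cl K b}+PrW D p {K : Finset (Sym2 V) | b ∈ cl K a ∧ c ∉ cl K a}+PrW D p {K : Finset (Sym2 V) | c ∈ cl K a ∧ b ∉ cl K a}+PrW D p {K : Finset (Sym2 V) | b ∉ cl K a ∧ c ∉ cl K a ∧ c ∈ cl K b}+PrW D p {K : Finset (Sym2 V) | b ∈ cl K a ∧ c ∈ cl K a}) - (PrW D p {K : Finset (Sym2 V) | b ∉ cl K a ∧ c ∉ cl K a ∧ c ∉ cl K b}+PrW D p {K : Finset (Sym2 V) | b ∈ cl K a ∧ c ∉ cl K a}+PrW D p {K : Finset (Sym2 V) | c ∈ cl K a ∧ b ∉ cl K a})*(3*PrW D p {K : Finset (Sym2 V) | b ∈ cl K a ∧ c ∉ cl K a}+PrW D p {K : Finset (Sym2 V) | c ∈ cl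 K a ∧ b ∉ cl K a}+2*PrW D p {K : Finset (Sym2 V) | b ∈ cl K a ∧ c ∈ cl K a})
      ∧ (PrW D p {K : Finset (Sym2 V) | b ∈ cl K a ∧ c ∉ cl K a}+PrW D p {K : Finset (Sym2 V) | c ∈ cl K a ∧ b ∉ cl K a})*(PrW D p {K : Finset (Sym2 V) | b ∉ cl K a ∧ c ∉ cl K a ∧ c ∉ cl K b}+PrW D p {K : Finset (Sym2 V) | b ∈ cl K a ∧ c ∉ cl K a}+PrW D p {K : Finset (Sym2 V) | c ∈ cl K a ∧ b ∉ cl K a}+PrW D p {K : Finset (Sym2 V) | b ∉ cl K a ∧ c ∉ cl K a ∧ c ∈ cl K b}+PrW D p {K : Finset (Sym2 V) | b ∈ cl K a ∧ c ∈ cl K a})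
        ≤ (PrW D p {K : Finset (Sym2 V) | b ∈ cl K a ∧ c ∉ cl K a}+PrW D p {K : Finset (Sym2 V) | c ∈ cl K a ∧ b ∉ cl K a}+PrW D p {K : Finset (Sym2 V) | b ∈ cl K a ∧ c ∈ cl K a})*(PrW D p {K : Finset (Sym2 V) | b ∉ cl K a ∧ c ∉ cl K a ∧ c ∉ cl K b}+PrW D p {K : Finset (Sym2 V) | b ∈ cl K a ∧ c ∉ cl K a}+PrW D p {K : Finset (Sym2 V) | c ∈ cl K a ∧ b ∉ cl K a})
      ∧ ((PrW D p {K : Finset (Sym2 V) | b ∈ cl K a ∧ c ∉ cl K a}+PrW D p {K : Finset (Sym2 V) | c ∈ cl K a ∧ b ∉ cl K a}+PrW D p {K : Finset (Sym2 V) | b ∈ cl K a ∧ c ∈ cl K a})*(PrW D p {K : Finset (Sym2 V) | b ∉ cl K a ∧ c ∉ cl K a ∧ c ∉ cl K b}+PrW D p {K : Finset (Sym2 V) | b ∈ cl K a ∧ c ∉ cl K a}+PrW D p {K : Finset (Sym2 V) | c ∈ cl K a ∧ b ∉ cl K a}) - (PrW D p {K : Finset (Sym2 V) | b ∈ cl K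 a ∧ c ∉ cl K a}+PrW D p {K : Finset (Sym2 V) | c ∈ cl K a ∧ b ∉ cl K a})*(PrW D p {K : Finset (Sym2 V) | b ∉ cl K a ∧ c ∉ cl K a ∧ c ∉ cl K b}+PrW D p {K : Finset (Sym2 V) | b ∈ cl K a ∧ c ∉ cl K a}+PrW D p {K : Finset (Sym2 V) | c ∈ cl K a ∧ b ∉ cl K a}+PrW D p {K : Finset (Sym2 V) | b ∉ cl K a ∧ c ∉ cl K a ∧ c ∈ cl K b}+PrW D p {K : Finset (Sym2 V) | b ∈ cl K a ∧ c ∈ cl K a}))^2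
        ≤ PrW D p {K : Finset (Sym2 V) | b ∈ cl K a ∧ c ∉ cl K a}*PrW D p {K : Finset (Sym2 V) | c ∈ cl K a ∧ b ∉ cl K a}*(PrW D p {K : Finset (Sym2 V) | b ∉ cl K a ∧ c ∉ cl K a ∧ c ∉ cl K b}+PrW D p {K : Finset (Sym2 V) | b ∈ cl K a ∧ c ∉ cl K a}+PrW D p {K : Finset (Sym2 V) | c ∈ cl K a ∧ b ∉ cl K a}+PrW D p {K : Finset (Sym2 V) | b ∉ cl K a ∧ c ∉ cl K a ∧ c ∈ cl K b}+PrW D p {K : Finset (Sym2 V) | b ∈ cl K a ∧ c ∈ cl K a})^2) := by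
  obtain ⟨rb, rc, rh, rg⟩ := h
  have hz := hp0 s(a, g)
  rw [pendant_cell_zero p D a g b c hag hba hca he hD, pendant_cell_ab p D a g b c hag hba hca he hD, pendant_cell_ac p D a g b c hag hba hca he hD,
    pendant_cell_bc p D a g b c hag hba hca he hD, pendant_cell_three p D a g b c hag hba hca he hD, pendant_split_bc p _ g b c,
    pendant_split_bc' p _ g b c]
  refine ⟨?_, ?_, ?_, ?_⟩
  · linear_combination mul_nonneg hz rb
  · linear_combination mul_nonneg hz rc
  · linear_combination mul_le_mul_of_nonneg_left rh hz
  · linear_combination mul_le_mul_of_nonneg_left rg (mul_nonneg hz hz)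

/-- An `a`-free piece lies in `K` (cells `(P(b ↮ c), 0, 0, P(b ↔ c), 0)`). [folklore] -/
theorem region_afree (p : Sym2 V → ℝ) (D : Finset (Sym2 V)) (a b c : V) (hba : b ≠ a) (hca : c ≠ a) (hD : ∀ f ∈ D, a ∉ f) :
    (0 ≤ 3*(PrW D p {K : Finset (Sym2 V) | b ∈ cl K a ∧ c ∉ cl K a}+PrW D p {K : Finset (Sym2 V) | c ∈ cl K a ∧ b ∉ cl K a})*(PrW D p {K : Finset (Sym2 V) | b ∉ cl K a ∧ c ∉ cl K a ∧ c ∉ cl K b}+PrW D p {K : Finset (Sym2 V) | b ∈ cl K a ∧ c ∉ cl K a}+PrW D p {K : Finset (Sym2 V) | c ∈ cl K a ∧ b ∉ cl K a}+PrW D p {K : Finset (Sym2 V) | b ∉ cl K a ∧ c ∉ cl K a ∧ c ∈ cl K b}+PrW D p {K : Finset (Sym2 V) | b ∈ cl K a ∧ c ∈ cl K a}) - (PrW D p {K : Finset (Sym2 V) | b ∉ cl K a ∧ c ∉ cl K a ∧ c ∉ cl K b}+PrW D p {K : Finset (Sym2 V) | b ∈ cl K a ∧ c ∉ cl K a}+PrW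 D p {K : Finset (Sym2 V) | c ∈ cl K a ∧ b ∉ cl K a})*(PrW D p {K : Finset (Sym2 V) | b ∈ cl K a ∧ c ∉ cl K a}+3*PrW D p {K : Finset (Sym2 V) | c ∈ cl K a ∧ b ∉ cl K a}+2*PrW D p {K : Finset (Sym2 V) | b ∈ cl K a ∧ c ∈ cl K a})
      ∧ 0 ≤ 3*(PrW D p {K : Finset (Sym2 V) | b ∈ cl K a ∧ c ∉ cl K a}+PrW D p {K : Finset (Sym2 V) | c ∈ cl K a ∧ b ∉ cl K a})*(PrW D p {K : Finset (Sym2 V) | b ∉ cl K a ∧ c ∉ cl K a ∧ c ∉ cl K b}+PrW D p {K : Finset (Sym2 V) | b ∈ cl K a ∧ c ∉ cl K a}+PrW D p {K : Finset (Sym2 V) | c ∈ cl K a ∧ b ∉ cl K a}+PrW D p {K : Finset (Sym2 V) | b ∉ cl K a ∧ c ∉ cl K a ∧ c ∈ cl K b}+PrW D p {K : Finset (Sym2 V) | b ∈ cl K a ∧ c ∈ cl K a}) - (PrW D p {K : Finset (Sym2 V) | b ∉ cl K a ∧ c ∉ cl K a ∧ c ∉ cl K b}+PrW D p {K : Finset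 (Sym2 V) | b ∈ cl K a ∧ c ∉ cl K a}+PrW D p {K : Finset (Sym2 V) | c ∈ cl K a ∧ b ∉ cl K a})*(3*PrW D p {K : Finset (Sym2 V) | b ∈ cl K a ∧ c ∉ cl K a}+PrW D p {K : Finset (Sym2 V) | c ∈ cl K a ∧ b ∉ cl K a}+2*PrW D p {K : Finset (Sym2 V) | b ∈ cl K a ∧ c ∈ cl K a})
      ∧ (PrW D p {K : Finset (Sym2 V) | b ∈ cl K a ∧ c ∉ cl K a}+PrW D p {K : Finset (Sym2 V) | c ∈ cl K a ∧ b ∉ cl K a})*(PrW D p {K : Finset (Sym2 V) | b ∉ cl K a ∧ c ∉ cl K a ∧ c ∉ cl K b}+PrW D p {K : Finset (Sym2 V) | b ∈ cl K a ∧ c ∉ cl K a}+PrW D p {K : Finset (Sym2 V) | c ∈ cl K a ∧ b ∉ cl K a}+PrW D p {K : Finset (Sym2 V) | b ∉ cl K a ∧ c ∉ cl K a ∧ c ∈ cl K b}+PrW D p {K : Finset (Sym2 V) | b ∈ cl K a ∧ c ∈ cl K a})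
        ≤ (PrW D p {K : Finset (Sym2 V) | b ∈ cl K a ∧ c ∉ cl K a}+PrW D p {K : Finset (Sym2 V) | c ∈ cl K a ∧ b ∉ cl K a}+PrW D p {K : Finset (Sym2 V) | b ∈ cl K a ∧ c ∈ cl K a})*(PrW D p {K : Finset (Sym2 V) | b ∉ cl K a ∧ c ∉ cl K a ∧ c ∉ cl K b}+PrW D p {K : Finset (Sym2 V) | b ∈ cl K a ∧ c ∉ cl K a}+PrW D p {K : Finset (Sym2 V) | c ∈ cl K a ∧ b ∉ cl K a})
      ∧ ((PrW D p {K : Finset (Sym2 V) | b ∈ cl K a ∧ c ∉ cl K a}+PrW D p {K : Finset (Sym2 V) | c ∈ cl K a ∧ b ∉ cl K a}+PrW D p {K : Finset (Sym2 V) | b ∈ cl K a ∧ c ∈ cl K a})*(PrW D p {K : Finset (Sym2 V) | b ∉ cl K a ∧ c ∉ cl K a ∧ c ∉ cl K b}+PrW D p {K : Finset (Sym2 V) | b ∈ cl K a ∧ c ∉ cl K a}+PrW D p {K : Finset (Sym2 V) | c ∈ cl K a ∧ b ∉ cl K a}) - (PrW D p {K : Finset (Sym2 V) | b ∈ cl K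 a ∧ c ∉ cl K a}+PrW D p {K : Finset (Sym2 V) | c ∈ cl K a ∧ b ∉ cl K a})*(PrW D p {K : Finset (Sym2 V) | b ∉ cl K a ∧ c ∉ cl K a ∧ c ∉ cl K b}+PrW D p {K : Finset (Sym2 V) | b ∈ cl K a ∧ c ∉ cl K a}+PrW D p {K : Finset (Sym2 V) | c ∈ cl K a ∧ b ∉ cl K a}+PrW D p {K : Finset (Sym2 V) | b ∉ cl K a ∧ c ∉ cl K a ∧ c ∈ cl K b}+PrW D p {K : Finset (Sym2 V) | b ∈ cl K a ∧ c ∈ cl K a}))^2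
        ≤ PrW D p {K : Finset (Sym2 V) | b ∈ cl K a ∧ c ∉ cl K a}*PrW D p {K : Finset (Sym2 V) | c ∈ cl K a ∧ b ∉ cl K a}*(PrW D p {K : Finset (Sym2 V) | b ∉ cl K a ∧ c ∉ cl K a ∧ c ∉ cl K b}+PrW D p {K : Finset (Sym2 V) | b ∈ cl K a ∧ c ∉ cl K a}+PrW D p {K : Finset (Sym2 V) | c ∈ cl K a ∧ b ∉ cl K a}+PrW D p {K : Finset (Sym2 V) | b ∉ cl K a ∧ c ∉ cl K a ∧ c ∈ cl K b}+PrW D p {K : Finset (Sym2 V) | b ∈ cl K a ∧ c ∈ cl K a})^2) := by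
  rw [afree_cell_zero p D a b c hba hca hD, afree_cell_ab p D a b c hba hD, afree_cell_ac p D a b c hca hD, afree_cell_bc p D a b c hba hca hD,
    afree_cell_three p D a b c hba hD]
  refine ⟨?_, ?_, ?_, ?_⟩ <;> nlinarith

/-- A single `a–b` edge lies in `K` (cells `(1−x, x, 0, 0, 0)`). [folklore] -/
theorem region_bEdge {p : Sym2 V → ℝ} (hp0 : ∀ e, 0 ≤ p e) (a b c : V) (hab : a ≠ b) (hac : a ≠ c) (hbc : b ≠ c) :
    (0 ≤ 3*(PrW ({s(a, b)} : Finset (Sym2 V)) p {K : Finset (Sym2 V) | b ∈ cl K a ∧ c ∉ cl K a}+PrW ({s(a, b)} : Finset (Sym2 V)) p {K : Finset (Sym2 V) | c ∈ cl K a ∧ b ∉ cl K a})*(PrW ({s(a, b)} : Finset (Sym2 V)) p {K : Finset (Sym2 V) | b ∉ cl K a ∧ c ∉ cl K a ∧ c ∉ cl K b}+PrW ({s(a, b)} : Finset (Sym2 V)) p {K : Finset (Sym2 V) | b ∈ cl K a ∧ c ∉ cl K a}+PrW ({s(a, b)} : Finset (Sym2 V)) p {K : Finset (Sym2 V) | c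 ∈ cl K a ∧ b ∉ cl K a}+PrW ({s(a, b)} : Finset (Sym2 V)) p {K : Finset (Sym2 V) | b ∉ cl K a ∧ c ∉ cl K a ∧ c ∈ cl K b}+PrW ({s(a, b)} : Finset (Sym2 V)) p {K : Finset (Sym2 V) | b ∈ cl K a ∧ c ∈ cl K a}) - (PrW ({s(a, b)} : Finset (Sym2 V)) p {K : Finset (Sym2 V) | b ∉ cl K a ∧ c ∉ cl K a ∧ c ∉ cl K b}+PrW ({s(a, b)} : Finset (Sym2 V)) p {K : Finset (Sym2 V) | b ∈ cl K a ∧ c ∉ cl K a}+PrW ({s(a, b)} : Finset (Sym2 V)) p {K : Finset (Sym2 V) | c ∈ cl K a ∧ b ∉ cl K a})*(PrW ({s(a, b)} : Finset (Sym2 V)) p {K : Finset (Sym2 V) | b ∈ cl K a ∧ c ∉ cl K a}+3*PrW ({s(a, b)} : Finset (Sym2 V)) p {K : Finset (Sym2 V) | c ∈ cl K a ∧ b ∉ cl K a}+2*PrW ({s(a, b)} : Finset (Sym2 V)) p {K : Finset (Sym2 V) | b ∈ cl K a ∧ c ∈ cl K a})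
      ∧ 0 ≤ 3*(PrW ({s(a, b)} : Finset (Sym2 V)) p {K : Finset (Sym2 V) | b ∈ cl K a ∧ c ∉ cl K a}+PrW ({s(a, b)} : Finset (Sym2 V)) p {K : Finset (Sym2 V) | c ∈ cl K a ∧ b ∉ cl K a})*(PrW ({s(a, b)} : Finset (Sym2 V)) p {K : Finset (Sym2 V) | b ∉ cl K a ∧ c ∉ cl K a ∧ c ∉ cl K b}+PrW ({s(a, b)} : Finset (Sym2 V)) p {K : Finset (Sym2 V) | b ∈ cl K a ∧ c ∉ cl K a}+PrW ({s(a, b)} : Finset (Sym2 V)) p {K : Finset (Sym2 V) | c ∈ cl K a ∧ b ∉ cl K a}+PrW ({s(a, b)} : Finset (Sym2 V)) p {K : Finset (Sym2 V) | b ∉ cl K a ∧ c ∉ cl K a ∧ c ∈ cl K b}+PrW ({s(a, b)} : Finset (Sym2 V)) p {K : Finset (Sym2 V) | b ∈ cl K a ∧ c ∈ cl K a}) - (PrW ({s(a, b)} : Finset (Sym2 V)) p {K : Finset (Sym2 V) | b ∉ cl K a ∧ c ∉ cl K a ∧ c ∉ cl K b}+PrW ({s(a, b)} : Finset (Sym2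 V)) p {K : Finset (Sym2 V) | b ∈ cl K a ∧ c ∉ cl K a}+PrW ({s(a, b)} : Finset (Sym2 V)) p {K : Finset (Sym2 V) | c ∈ cl K a ∧ b ∉ cl K a})*(3*PrW ({s(a, b)} : Finset (Sym2 V)) p {K : Finset (Sym2 V) | b ∈ cl K a ∧ c ∉ cl K a}+PrW ({s(a, b)} : Finset (Sym2 V)) p {K : Finset (Sym2 V) | c ∈ cl K a ∧ b ∉ cl K a}+2*PrW ({s(a, b)} : Finset (Sym2 V)) p {K : Finset (Sym2 V) | b ∈ cl K a ∧ c ∈ cl K a})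
      ∧ (PrW ({s(a, b)} : Finset (Sym2 V)) p {K : Finset (Sym2 V) | b ∈ cl K a ∧ c ∉ cl K a}+PrW ({s(a, b)} : Finset (Sym2 V)) p {K : Finset (Sym2 V) | c ∈ cl K a ∧ b ∉ cl K a})*(PrW ({s(a, b)} : Finset (Sym2 V)) p {K : Finset (Sym2 V) | b ∉ cl K a ∧ c ∉ cl K a ∧ c ∉ cl K b}+PrW ({s(a, b)} : Finset (Sym2 V)) p {K : Finset (Sym2 V) | b ∈ cl K a ∧ c ∉ cl K a}+PrW ({s(a, b)} : Finset (Sym2 V)) p {K : Finset (Sym2 V) | c ∈ cl K a ∧ b ∉ cl K a}+PrW ({s(a, b)} : Finset (Sym2 V)) p {K : Finset (Sym2 V) | b ∉ cl K a ∧ c ∉ cl K a ∧ c ∈ cl K b}+PrW ({s(a, b)} : Finset (Sym2 V)) p {K : Finset (Sym2 V) | b ∈ cl K a ∧ c ∈ cl K a})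
        ≤ (PrW ({s(a, b)} : Finset (Sym2 V)) p {K : Finset (Sym2 V) | b ∈ cl K a ∧ c ∉ cl K a}+PrW ({s(a, b)} : Finset (Sym2 V)) p {K : Finset (Sym2 V) | c ∈ cl K a ∧ b ∉ cl K a}+PrW ({s(a, b)} : Finset (Sym2 V)) p {K : Finset (Sym2 V) | b ∈ cl K a ∧ c ∈ cl K a})*(PrW ({s(a, b)} : Finset (Sym2 V)) p {K : Finset (Sym2 V) | b ∉ cl K a ∧ c ∉ cl K a ∧ c ∉ cl K b}+PrW ({s(a, b)} : Finset (Sym2 V)) p {K : Finset (Sym2 V) | b ∈ cl K a ∧ c ∉ cl K a}+PrW ({s(a, b)} : Finset (Sym2 V)) p {K : Finset (Sym2 V) | c ∈ cl K a ∧ b ∉ cl K a})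
      ∧ ((PrW ({s(a, b)} : Finset (Sym2 V)) p {K : Finset (Sym2 V) | b ∈ cl K a ∧ c ∉ cl K a}+PrW ({s(a, b)} : Finset (Sym2 V)) p {K : Finset (Sym2 V) | c ∈ cl K a ∧ b ∉ cl K a}+PrW ({s(a, b)} : Finset (Sym2 V)) p {K : Finset (Sym2 V) | b ∈ cl K a ∧ c ∈ cl K a})*(PrW ({s(a, b)} : Finset (Sym2 V)) p {K : Finset (Sym2 V) | b ∉ cl K a ∧ c ∉ cl K a ∧ c ∉ cl K b}+PrW ({s(a, b)} : Finset (Sym2 V)) p {K : Finset (Sym2 V) | b ∈ cl K a ∧ c ∉ cl K a}+PrW ({s(a, b)} : Finset (Sym2 V)) p {K : Finset (Sym2 V) | c ∈ cl K a ∧ b ∉ cl K a}) - (PrW ({s(a, b)} : Finset (Sym2 V)) p {K : Finset (Sym2 V) | b ∈ cl K a ∧ c ∉ cl K a}+PrW ({s(a, b)} : Finset (Sym2 V)) p {K : Finset (Sym2 V) | c ∈ cl K a ∧ b ∉ cl K a})*(PrW ({s(a, b)} : Finset (Sym2 V)) p {K : Finset (Sym2 V) | b ∉ cl K a ∧ c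 ∉ cl K a ∧ c ∉ cl K b}+PrW ({s(a, b)} : Finset (Sym2 V)) p {K : Finset (Sym2 V) | b ∈ cl K a ∧ c ∉ cl K a}+PrW ({s(a, b)} : Finset (Sym2 V)) p {K : Finset (Sym2 V) | c ∈ cl K a ∧ b ∉ cl K a}+PrW ({s(a, b)} : Finset (Sym2 V)) p {K : Finset (Sym2 V) | b ∉ cl K a ∧ c ∉ cl K a ∧ c ∈ cl K b}+PrW ({s(a, b)} : Finset (Sym2 V)) p {K : Finset (Sym2 V) | b ∈ cl K a ∧ c ∈ cl K a}))^2
        ≤ PrW ({s(a, b)} : Finset (Sym2 V)) p {K : Finset (Sym2 V) | b ∈ cl K a ∧ c ∉ cl K a}*PrW ({s(a, b)} : Finset (Sym2 V)) p {K : Finset (Sym2 V) | c ∈ cl K a ∧ b ∉ cl K a}*(PrW ({s(a, b)} : Finset (Sym2 V)) p {K : Finset (Sym2 V) | b ∉ cl K a ∧ c ∉ cl K a ∧ c ∉ cl K b}+PrW ({s(a, b)} : Finset (Sym2 V)) p {K : Finset (Sym2 V) | b ∈ cl K a ∧ c ∉ cl K a}+PrW ({s(a, b)} : Finset (Sym2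 V)) p {K : Finset (Sym2 V) | c ∈ cl K a ∧ b ∉ cl K a}+PrW ({s(a, b)} : Finset (Sym2 V)) p {K : Finset (Sym2 V) | b ∉ cl K a ∧ c ∉ cl K a ∧ c ∈ cl K b}+PrW ({s(a, b)} : Finset (Sym2 V)) p {K : Finset (Sym2 V) | b ∈ cl K a ∧ c ∈ cl K a})^2) := by
  rw [bEdge_cell_zero p a b c hab hac hbc, bEdge_cell_ab p a b c hab hac hbc, bEdge_cell_ac p a b c hab hac hbc, bEdge_cell_bc p a b c hab hac hbc,
    bEdge_cell_three p a b c hab hac hbc]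
  have hx := hp0 s(a, b)
  refine ⟨?_, ?_, ?_, ?_⟩ <;> nlinarith

/-- A single `a–c` edge lies in `K` (cells `(1−x, 0, x, 0, 0)`). [folklore] -/
theorem region_cEdge {p : Sym2 V → ℝ} (hp0 : ∀ e, 0 ≤ p e) (a b c : V) (hab : a ≠ b) (hac : a ≠ c) (hbc : b ≠ c) :
    (0 ≤ 3*(PrW ({s(a, c)} : Finset (Sym2 V)) p {K : Finset (Sym2 V) | b ∈ cl K a ∧ c ∉ cl K a}+PrW ({s(a, c)} : Finset (Sym2 V)) p {K : Finset (Sym2 V) | c ∈ cl K a ∧ b ∉ cl K a})*(PrW ({s(a, c)} : Finset (Sym2 V)) p {K : Finset (Sym2 V) | b ∉ cl K a ∧ c ∉ cl K a ∧ c ∉ cl K b}+PrW ({s(a, c)} : Finset (Sym2 V)) p {K : Finset (Sym2 V) | b ∈ cl K a ∧ c ∉ cl K a}+PrW ({s(a, c)} : Finset (Sym2 V)) p {K : Finset (Sym2 V) | c ∈ cl K a ∧ b ∉ cl K a}+PrW ({s(a, c)} : Finset (Sym2 V)) p {K : Finset (Sym2 V) | b ∉ cl K a ∧ c ∉ cl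 K a ∧ c ∈ cl K b}+PrW ({s(a, c)} : Finset (Sym2 V)) p {K : Finset (Sym2 V) | b ∈ cl K a ∧ c ∈ cl K a}) - (PrW ({s(a, c)} : Finset (Sym2 V)) p {K : Finset (Sym2 V) | b ∉ cl K a ∧ c ∉ cl K a ∧ c ∉ cl K b}+PrW ({s(a, c)} : Finset (Sym2 V)) p {K : Finset (Sym2 V) | b ∈ cl K a ∧ c ∉ cl K a}+PrW ({s(a, c)} : Finset (Sym2 V)) p {K : Finset (Sym2 V) | c ∈ cl K a ∧ b ∉ cl K a})*(PrW ({s(a, c)} : Finset (Sym2 V)) p {K : Finset (Sym2 V) | b ∈ cl K a ∧ c ∉ cl K a}+3*PrW ({s(a, c)} : Finset (Sym2 V)) p {K : Finset (Sym2 V) | c ∈ cl K a ∧ b ∉ cl K a}+2*PrW ({s(a, c)} : Finset (Sym2 V)) p {K : Finset (Sym2 V) | b ∈ cl K a ∧ c ∈ cl K a})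
      ∧ 0 ≤ 3*(PrW ({s(a, c)} : Finset (Sym2 V)) p {K : Finset (Sym2 V) | b ∈ cl K a ∧ c ∉ cl K a}+PrW ({s(a, c)} : Finset (Sym2 V)) p {K : Finset (Sym2 V) | c ∈ cl K a ∧ b ∉ cl K a})*(PrW ({s(a, c)} : Finset (Sym2 V)) p {K : Finset (Sym2 V) | b ∉ cl K a ∧ c ∉ cl K a ∧ c ∉ cl K b}+PrW ({s(a, c)} : Finset (Sym2 V)) p {K : Finset (Sym2 V) | b ∈ cl K a ∧ c ∉ cl K a}+PrW ({s(a, c)} : Finset (Sym2 V)) p {K : Finset (Sym2 V) | c ∈ cl K a ∧ b ∉ cl K a}+PrW ({s(a, c)} : Finset (Sym2 V)) p {K : Finset (Sym2 V) | b ∉ cl K a ∧ c ∉ cl K a ∧ c ∈ cl K b}+PrW ({s(a, c)} : Finset (Sym2 V)) p {K : Finset (Sym2 V) | b ∈ cl K a ∧ c ∈ cl K a}) - (PrW ({s(a, c)} : Finset (Sym2 V)) p {K : Finset (Sym2 V) | b ∉ cl K a ∧ c ∉ cl K a ∧ c ∉ cl K b}+PrW ({s(a, c)} : Finset (Sym2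 V)) p {K : Finset (Sym2 V) | b ∈ cl K a ∧ c ∉ cl K a}+PrW ({s(a, c)} : Finset (Sym2 V)) p {K : Finset (Sym2 V) | c ∈ cl K a ∧ b ∉ cl K a})*(3*PrW ({s(a, c)} : Finset (Sym2 V)) p {K : Finset (Sym2 V) | b ∈ cl K a ∧ c ∉ cl K a}+PrW ({s(a, c)} : Finset (Sym2 V)) p {K : Finset (Sym2 V) | c ∈ cl K a ∧ b ∉ cl K a}+2*PrW ({s(a, c)} : Finset (Sym2 V)) p {K : Finset (Sym2 V) | b ∈ cl K a ∧ c ∈ cl K a})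
      ∧ (PrW ({s(a, c)} : Finset (Sym2 V)) p {K : Finset (Sym2 V) | b ∈ cl K a ∧ c ∉ cl K a}+PrW ({s(a, c)} : Finset (Sym2 V)) p {K : Finset (Sym2 V) | c ∈ cl K a ∧ b ∉ cl K a})*(PrW ({s(a, c)} : Finset (Sym2 V)) p {K : Finset (Sym2 V) | b ∉ cl K a ∧ c ∉ cl K a ∧ c ∉ cl K b}+PrW ({s(a, c)} : Finset (Sym2 V)) p {K : Finset (Sym2 V) | b ∈ cl K a ∧ c ∉ cl K a}+PrW ({s(a, c)} : Finset (Sym2 V)) p {K : Finset (Sym2 V) | c ∈ cl K a ∧ b ∉ cl K a}+PrW ({s(a, c)} : Finset (Sym2 V)) p {K : Finset (Sym2 V) | b ∉ cl K a ∧ c ∉ cl K a ∧ c ∈ cl K b}+PrW ({s(a, c)} : Finset (Sym2 V)) p {K : Finset (Sym2 V) | b ∈ cl K a ∧ c ∈ cl K a})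
        ≤ (PrW ({s(a, c)} : Finset (Sym2 V)) p {K : Finset (Sym2 V) | b ∈ cl K a ∧ c ∉ cl K a}+PrW ({s(a, c)} : Finset (Sym2 V)) p {K : Finset (Sym2 V) | c ∈ cl K a ∧ b ∉ cl K a}+PrW ({s(a, c)} : Finset (Sym2 V)) p {K : Finset (Sym2 V) | b ∈ cl K a ∧ c ∈ cl K a})*(PrW ({s(a, c)} : Finset (Sym2 V)) p {K : Finset (Sym2 V) | b ∉ cl K a ∧ c ∉ cl K a ∧ c ∉ cl K b}+PrW ({s(a, c)} : Finset (Sym2 V)) p {K : Finset (Sym2 V) | b ∈ cl K a ∧ c ∉ cl K a}+PrW ({s(a, c)} : Finset (Sym2 V)) p {K : Finset (Sym2 V) | c ∈ cl K a ∧ b ∉ cl K a})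
      ∧ ((PrW ({s(a, c)} : Finset (Sym2 V)) p {K : Finset (Sym2 V) | b ∈ cl K a ∧ c ∉ cl K a}+PrW ({s(a, c)} : Finset (Sym2 V)) p {K : Finset (Sym2 V) | c ∈ cl K a ∧ b ∉ cl K a}+PrW ({s(a, c)} : Finset (Sym2 V)) p {K : Finset (Sym2 V) | b ∈ cl K a ∧ c ∈ cl K a})*(PrW ({s(a, c)} : Finset (Sym2 V)) p {K : Finset (Sym2 V) | b ∉ cl K a ∧ c ∉ cl K a ∧ c ∉ cl K b}+PrW ({s(a, c)} : Finset (Sym2 V)) p {K : Finset (Sym2 V) | b ∈ cl K a ∧ c ∉ cl K a}+PrW ({s(a, c)} : Finset (Sym2 V)) p {K : Finset (Sym2 V) | c ∈ cl K a ∧ b ∉ cl K a}) - (PrW ({s(a, c)} : Finset (Sym2 V)) p {K : Finset (Sym2 V) | b ∈ cl K a ∧ c ∉ cl K a}+PrW ({s(a, c)} : Finset (Sym2 V)) p {K : Finset (Sym2 V) | c ∈ cl K a ∧ b ∉ cl K a})*(PrW ({s(a, c)} : Finset (Sym2 V)) p {K : Finset (Sym2 V) | b ∉ cl K a ∧ c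 ∉ cl K a ∧ c ∉ cl K b}+PrW ({s(a, c)} : Finset (Sym2 V)) p {K : Finset (Sym2 V) | b ∈ cl K a ∧ c ∉ cl K a}+PrW ({s(a, c)} : Finset (Sym2 V)) p {K : Finset (Sym2 V) | c ∈ cl K a ∧ b ∉ cl K a}+PrW ({s(a, c)} : Finset (Sym2 V)) p {K : Finset (Sym2 V) | b ∉ cl K a ∧ c ∉ cl K a ∧ c ∈ cl K b}+PrW ({s(a, c)} : Finset (Sym2 V)) p {K : Finset (Sym2 V) | b ∈ cl K a ∧ c ∈ cl K a}))^2
        ≤ PrW ({s(a, c)} : Finset (Sym2 V)) p {K : Finset (Sym2 V) | b ∈ cl K a ∧ c ∉ cl K a}*PrW ({s(a, c)} : Finset (Sym2 V)) p {K : Finset (Sym2 V) | c ∈ cl K a ∧ b ∉ cl K a}*(PrW ({s(a, c)} : Finset (Sym2 V)) p {K : Finset (Sym2 V) | b ∉ cl K a ∧ c ∉ cl K a ∧ c ∉ cl K b}+PrW ({s(a, c)} : Finset (Sym2 V)) p {K : Finset (Sym2 V) | b ∈ cl K a ∧ c ∉ cl K a}+PrW ({s(a, c)} : Finset (Sym2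 V)) p {K : Finset (Sym2 V) | c ∈ cl K a ∧ b ∉ cl K a}+PrW ({s(a, c)} : Finset (Sym2 V)) p {K : Finset (Sym2 V) | b ∉ cl K a ∧ c ∉ cl K a ∧ c ∈ cl K b}+PrW ({s(a, c)} : Finset (Sym2 V)) p {K : Finset (Sym2 V) | b ∈ cl K a ∧ c ∈ cl K a})^2) := by
  rw [cEdge_cell_zero p a b c hab hac hbc, cEdge_cell_ab p a b c hab hac hbc, cEdge_cell_ac p a b c hab hac hbc, cEdge_cell_bc p a b c hab hac hbc,
    cEdge_cell_three p a b c hab hac hbc]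
  have hx := hp0 s(a, c)
  refine ⟨?_, ?_, ?_, ?_⟩ <;> nlinarith

set_option maxHeartbeats 0 in
/-- **THEOREM F_T** (memo gen 34 §2 / gen 35 §2 / gen 36 §5).  `0 ≤ p ≤ 1`, `D` loop-free, `a, b, c` distinct, and the forest part
`D.filter (b ∉ · ∧ c ∉ ·)` acyclic (every one of its edges `s(u,v)` separates `u` from `v` in the rest of it).  Then the cells of `(a; b, c)` on
`D` satisfy `F_b ≥ 0`, `F_c ≥ 0` (prim-cert-1's CONJECTURE F), Harris and APL-G. [this work] -/
theorem conjF_forest {p : Sym2 V → ℝ} (hp0 : ∀ e, 0 ≤ p e) (hp1 : ∀ e, p e ≤ 1) (b c : V) (hbc : b ≠ c) :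
    ∀ (n : ℕ) (D : Finset (Sym2 V)) (a : V), D.card = n → a ≠ b → a ≠ c → (∀ f ∈ D, ¬ f.IsDiag) →
      (∀ u v : V, s(u, v) ∈ D → b ∉ s(u, v) → c ∉ s(u, v) →
        ¬ (openGraph (↑((D.filter fun f => b ∉ f ∧ c ∉ f).erase s(u, v)) : Set (Sym2 V))).Reachable u v) →
      (0 ≤ 3*(PrW D p {K : Finset (Sym2 V) | b ∈ cl K a ∧ c ∉ cl K a}+PrW D p {K : Finset (Sym2 V) | c ∈ cl K a ∧ b ∉ cl K a})*(PrW D p {K : Finset (Sym2 V) | b ∉ cl K a ∧ c ∉ cl K a ∧ c ∉ cl K b}+PrW D p {K : Finset (Sym2 V) | b ∈ cl K a ∧ c ∉ cl K a}+PrW D p {K : Finset (Sym2 V) | c ∈ cl K a ∧ b ∉ cl K a}+PrW D p {K : Finset (Sym2 V) | b ∉ cl K a ∧ c ∉ cl K a ∧ c ∈ cl K b}+PrW D p {K : Finset (Sym2 V) | b ∈ cl K a ∧ c ∈ cl K a}) - (PrW D p {K : Finset (Sym2 V) | b ∉ cl K a ∧ c ∉ cl K a ∧ c ∉ cl K b}+PrW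 D p {K : Finset (Sym2 V) | b ∈ cl K a ∧ c ∉ cl K a}+PrW D p {K : Finset (Sym2 V) | c ∈ cl K a ∧ b ∉ cl K a})*(PrW D p {K : Finset (Sym2 V) | b ∈ cl K a ∧ c ∉ cl K a}+3*PrW D p {K : Finset (Sym2 V) | c ∈ cl K a ∧ b ∉ cl K a}+2*PrW D p {K : Finset (Sym2 V) | b ∈ cl K a ∧ c ∈ cl K a})
      ∧ 0 ≤ 3*(PrW D p {K : Finset (Sym2 V) | b ∈ cl K a ∧ c ∉ cl K a}+PrW D p {K : Finset (Sym2 V) | c ∈ cl K a ∧ b ∉ cl K a})*(PrW D p {K : Finset (Sym2 V) | b ∉ cl K a ∧ c ∉ cl K a ∧ c ∉ cl K b}+PrW D p {K : Finset (Sym2 V) | b ∈ cl K a ∧ c ∉ cl K a}+PrW D p {K : Finset (Sym2 V) | c ∈ cl K a ∧ b ∉ cl K a}+PrW D p {K : Finset (Sym2 V) | b ∉ cl K a ∧ c ∉ cl K a ∧ c ∈ cl K b}+PrW D p {K : Finset (Sym2 V) | b ∈ cl K a ∧ c ∈ cl K a}) - (PrW D p {K : Finset (Sym2 V) | b ∉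 cl K a ∧ c ∉ cl K a ∧ c ∉ cl K b}+PrW D p {K : Finset (Sym2 V) | b ∈ cl K a ∧ c ∉ cl K a}+PrW D p {K : Finset (Sym2 V) | c ∈ cl K a ∧ b ∉ cl K a})*(3*PrW D p {K : Finset (Sym2 V) | b ∈ cl K a ∧ c ∉ cl K a}+PrW D p {K : Finset (Sym2 V) | c ∈ cl K a ∧ b ∉ cl K a}+2*PrW D p {K : Finset (Sym2 V) | b ∈ cl K a ∧ c ∈ cl K a})
      ∧ (PrW D p {K : Finset (Sym2 V) | b ∈ cl K a ∧ c ∉ cl K a}+PrW D p {K : Finset (Sym2 V) | c ∈ cl K a ∧ b ∉ cl K a})*(PrW D p {K : Finset (Sym2 V) | b ∉ cl K a ∧ c ∉ cl K a ∧ c ∉ cl K b}+PrW D p {K : Finset (Sym2 V) | b ∈ cl K a ∧ c ∉ cl K a}+PrW D p {K : Finset (Sym2 V) | c ∈ cl K a ∧ b ∉ cl K a}+PrW D p {K : Finset (Sym2 V) | b ∉ cl K a ∧ c ∉ cl K a ∧ c ∈ cl K b}+PrW D p {K : Finset (Sym2 V) | b ∈ cl K a ∧ c ∈ cl K a})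
        ≤ (PrW D p {K : Finset (Sym2 V) | b ∈ cl K a ∧ c ∉ cl K a}+PrW D p {K : Finset (Sym2 V) | c ∈ cl K a ∧ b ∉ cl K a}+PrW D p {K : Finset (Sym2 V) | b ∈ cl K a ∧ c ∈ cl K a})*(PrW D p {K : Finset (Sym2 V) | b ∉ cl K a ∧ c ∉ cl K a ∧ c ∉ cl K b}+PrW D p {K : Finset (Sym2 V) | b ∈ cl K a ∧ c ∉ cl K a}+PrW D p {K : Finset (Sym2 V) | c ∈ cl K a ∧ b ∉ cl K a})
      ∧ ((PrW D p {K : Finset (Sym2 V) | b ∈ cl K a ∧ c ∉ cl K a}+PrW D p {K : Finset (Sym2 V) | c ∈ cl K a ∧ b ∉ cl K a}+PrW D p {K : Finset (Sym2 V) | b ∈ cl K a ∧ c ∈ cl K a})*(PrW D p {K : Finset (Sym2 V) | b ∉ cl K a ∧ c ∉ cl K a ∧ c ∉ cl K b}+PrW D p {K : Finset (Sym2 V) | b ∈ cl K a ∧ c ∉ cl K a}+PrW D p {K : Finset (Sym2 V) | c ∈ cl K a ∧ b ∉ cl K a}) - (PrW D p {K : Finset (Sym2 V) | b ∈ cl K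 a ∧ c ∉ cl K a}+PrW D p {K : Finset (Sym2 V) | c ∈ cl K a ∧ b ∉ cl K a})*(PrW D p {K : Finset (Sym2 V) | b ∉ cl K a ∧ c ∉ cl K a ∧ c ∉ cl K b}+PrW D p {K : Finset (Sym2 V) | b ∈ cl K a ∧ c ∉ cl K a}+PrW D p {K : Finset (Sym2 V) | c ∈ cl K a ∧ b ∉ cl K a}+PrW D p {K : Finset (Sym2 V) | b ∉ cl K a ∧ c ∉ cl K a ∧ c ∈ cl K b}+PrW D p {K : Finset (Sym2 V) | b ∈ cl K a ∧ c ∈ cl K a}))^2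
        ≤ PrW D p {K : Finset (Sym2 V) | b ∈ cl K a ∧ c ∉ cl K a}*PrW D p {K : Finset (Sym2 V) | c ∈ cl K a ∧ b ∉ cl K a}*(PrW D p {K : Finset (Sym2 V) | b ∉ cl K a ∧ c ∉ cl K a ∧ c ∉ cl K b}+PrW D p {K : Finset (Sym2 V) | b ∈ cl K a ∧ c ∉ cl K a}+PrW D p {K : Finset (Sym2 V) | c ∈ cl K a ∧ b ∉ cl K a}+PrW D p {K : Finset (Sym2 V) | b ∉ cl K a ∧ c ∉ cl K a ∧ c ∈ cl K b}+PrW D p {K : Finset (Sym2 V) | b ∈ cl K a ∧ c ∈ cl K a})^2) := by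
  intro n
  induction n using Nat.strong_induction_on with
  | _ n ih =>
  intro D a hcard hab hac hloop hF
  -- (1) peel an `a–b` edge
  by_cases h1 : s(a, b) ∈ D
  · have hD : ({s(a, b)} : Finset (Sym2 V)) ∪ D.erase s(a, b) = D := by
      rw [← Finset.insert_eq, Finset.insert_erase h1]
    have hlt : (D.erase s(a, b)).card < n := by rw [← hcard]; exact Finset.card_erase_lt_of_mem h1
    have hrest := ih _ hlt (D.erase s(a, b)) a rfl hab hac (noLoop_mono (Finset.erase_subset _ _) hloop)
      (forest_mono (Finset.erase_subset _ _) b c hF)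
    rw [← hD]
    refine region_glue hp0 hp1 _ _ (Finset.disjoint_singleton_left.2 (Finset.notMem_erase _ _)) a b c ?_
      (region_bEdge hp0 a b c hab hac hbc) hrest
    rintro v ⟨f, hf, hvf⟩ _
    rw [Finset.mem_singleton] at hf
    rw [hf, Sym2.mem_iff] at hvf
    rcases hvf with h | h
    · exact Or.inl h
    · exact Or.inr (Or.inl h)
  -- (2) peel an `a–c` edge
  by_cases h2 : s(a, c) ∈ D
  · have hD : ({s(a, c)} : Finset (Sym2 V)) ∪ D.erase s(a, c) = D := by
      rw [← Finset.insert_eq, Finset.insert_erase h2]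
    have hlt : (D.erase s(a, c)).card < n := by rw [← hcard]; exact Finset.card_erase_lt_of_mem h2
    have hrest := ih _ hlt (D.erase s(a, c)) a rfl hab hac (noLoop_mono (Finset.erase_subset _ _) hloop)
      (forest_mono (Finset.erase_subset _ _) b c hF)
    rw [← hD]
    refine region_glue hp0 hp1 _ _ (Finset.disjoint_singleton_left.2 (Finset.notMem_erase _ _)) a b c ?_
      (region_cEdge hp0 a b c hab hac hbc) hrest
    rintro v ⟨f, hf, hvf⟩ _
    rw [Finset.mem_singleton] at hf
    rw [hf, Sym2.mem_iff] at hvf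
    rcases hvf with h | h
    · exact Or.inl h
    · exact Or.inr (Or.inr h)
  -- (3) `a` isolated
  by_cases h3 : ∃ f ∈ D, a ∈ f
  swap
  · exact region_afree p D a b c (Ne.symm hab) (Ne.symm hac) fun f hf haf => h3 ⟨f, hf, haf⟩
  -- (4) a non-terminal neighbour `g`
  obtain ⟨f, hf, haf⟩ := h3
  set g : V := Sym2.Mem.other haf with hg
  have hfg : f = s(a, g) := (Sym2.other_spec haf).symm
  have hga : g ≠ a := Sym2.other_ne (hloop f hf) haf
  have he : s(a, g) ∈ D := hfg ▸ hf
  have hgb : g ≠ b := fun h => h1 (h ▸ he)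
  have hgc : g ≠ c := fun h => h2 (h ▸ he)
  by_cases h4 : (D.filter fun f => ¬ ∃ v ∈ (cl (D.filter fun f => a ∉ f ∧ b ∉ f ∧ c ∉ f) g), v ∈ f) = ∅
  · -- (4B) the rest is empty: `a` is pendant on `g`
    have hG : (D.filter fun f => ∃ v ∈ (cl (D.filter fun f => a ∉ f ∧ b ∉ f ∧ c ∉ f) g), v ∈ f) = D := by
      have hu := apexSplit_union D a b c g
      rwa [h4, Finset.union_empty] at hu
    have honly : ∀ f ∈ D, a ∈ f → f = s(a, g) := by
      have hb : b ∉ s(a, g) := by rw [Sym2.mem_iff, not_or]; exact ⟨hab.symm, hgb.symm⟩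
      have hc : c ∉ s(a, g) := by rw [Sym2.mem_iff, not_or]; exact ⟨hac.symm, hgc.symm⟩
      have h := apexSplit_apex_edge D a b c g hab hac hga hgb hgc (hF a g he hb hc)
      rw [hG] at h
      exact h
    have hlt : (D.erase s(a, g)).card < n := by rw [← hcard]; exact Finset.card_erase_lt_of_mem he
    have hrest := ih _ hlt (D.erase s(a, g)) g rfl hgb hgc (noLoop_mono (Finset.erase_subset _ _) hloop)
      (forest_mono (Finset.erase_subset _ _) b c hF)
    exact region_pendant hp0 D a g b c hga.symm (Ne.symm hab) (Ne.symm hac) he honly hrest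
  · -- (4A) proper gluing of the piece through `g` and the rest
    have hHne : ((D.filter fun f => ¬ ∃ v ∈ (cl (D.filter fun f => a ∉ f ∧ b ∉ f ∧ c ∉ f) g), v ∈ f)).Nonempty := Finset.nonempty_iff_ne_empty.2 h4
    have hG1ne : ((D.filter fun f => ∃ v ∈ (cl (D.filter fun f => a ∉ f ∧ b ∉ f ∧ c ∉ f) g), v ∈ f)).Nonempty := ⟨_, apexSplit_mem D a b c g he⟩
    have hcardU := Finset.card_union_of_disjoint (apexSplit_disjoint D a b c g)
    rw [apexSplit_union D a b c g, hcard] at hcardU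
    have hpos1 := hG1ne.card_pos
    have hpos2 := hHne.card_pos
    have hsub1 : (D.filter fun f => ∃ v ∈ (cl (D.filter fun f => a ∉ f ∧ b ∉ f ∧ c ∉ f) g), v ∈ f) ⊆ D := Finset.filter_subset _ D
    have hsub2 : (D.filter fun f => ¬ ∃ v ∈ (cl (D.filter fun f => a ∉ f ∧ b ∉ f ∧ c ∉ f) g), v ∈ f) ⊆ D := Finset.filter_subset _ D
    have r1 := ih _ (by omega) (D.filter fun f => ∃ v ∈ (cl (D.filter fun f => a ∉ f ∧ b ∉ f ∧ c ∉ f) g), v ∈ f) a rfl hab hac (noLoop_mono hsub1 hloop) (forest_mono hsub1 b c hF)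
    have r2 := ih _ (by omega) (D.filter fun f => ¬ ∃ v ∈ (cl (D.filter fun f => a ∉ f ∧ b ∉ f ∧ c ∉ f) g), v ∈ f) a rfl hab hac (noLoop_mono hsub2 hloop) (forest_mono hsub2 b c hF)
    rw [← apexSplit_union D a b c g]
    exact region_glue hp0 hp1 _ _ (apexSplit_disjoint D a b c g) a b c (apexSplit_glued D a b c g hga hgb hgc) r1 r2

end APL

end Summit.CriticalPhenomena.PercolationContinuityZ3.Theorems
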